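import Mathlib.CategoryTheory.Groupoid
import Literature.AnabelianGeometry.AbsoluteAnabelian.MonoAnalyticLogShells

/-!
# `TM⊢` is a groupoid: the category structure on `TMMono` ([AbsTopIII] Definition 5.6 (i))

abc-iut cell, MERGE-MAP v3 §8 row **B5** (map writer abc-iut-L6-t7; bridge seat abc-iut-L6-d6; type
owner abc-iut-L4-t3, first refusal offered 2026-08-25T20:2xZ). Mochizuki, *Topics in Absolute Anabelian
Geometry III*, Def. 5.6 (i) (kurims p. 134): the category `TM⊢` whose objects are pairs `(C, C⃗)` of a
topological monoid `C ≅ 𝒪_ℂ^▷` with a submonoid `C⃗`, and whose "morphisms … are isomorphisms of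
topological monoids `C₁ ⥲ C₂` inducing `C⃗₁ ⥲ C⃗₂`". abc-iut-L4-t3 typed the objects (`TMMono`) and the
morphisms (`TMMono.Iso`, MonoAnalyticLogShells.lean p404450) but no `Category` instance; abc-iut-L6-t3's
prime-strip categories (`StripCat`, StripCategories.lean p404180; [IUTchI] Def 5.2 / [IUTchIII] Def 2.4
(ii): the `v ∈ V^arc` component "an object of `TM⊢`") need one to instantiate `TM⊢ := TMMono`. This file
supplies it: identity, composition and inverse of `TMMono.Iso`, an extensionality lemma, and
`instance : Groupoid TMMono` (every morphism is an isomorphism, as printed). No typer file is edited.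
[cite: MochizukiAbsTopIII2015, Def 5.6 (i) p. 134]
-/

namespace Literature.AnabelianGeometry.AbsoluteAnabelian

open CategoryTheory

universe u

namespace TMMono.Iso

variable {M₁ M₂ M₃ : TMMono.{u}}

/-- Two morphisms of `TM⊢` with the same underlying isomorphism of monoids are equal (the remaining
fields are propositions). [cite: MochizukiAbsTopIII2015, Def 5.6 (i) p. 134] -/
@[ext] theorem ext {e f : TMMono.Iso M₁ M₂} (h : e.toMulEquiv = f.toMulEquiv) : e = f := by
  cases e; cases f; cases h; rfl

/-- The identity morphism of an object of `TM⊢`. [cite: MochizukiAbsTopIII2015, Def 5.6 (i) p. 134] -/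
def refl (M : TMMono.{u}) : TMMono.Iso M M where
  toMulEquiv := MulEquiv.refl M.C
  continuous_toFun := continuous_id
  continuous_invFun := continuous_id
  map_pos := by simp

/-- Composition of morphisms of `TM⊢` ("isomorphisms of topological monoids … inducing `C⃗₁ ⥲ C⃗₂`"
compose). [cite: MochizukiAbsTopIII2015, Def 5.6 (i) p. 134] -/
def trans (e : TMMono.Iso M₁ M₂) (f : TMMono.Iso M₂ M₃) : TMMono.Iso M₁ M₃ where
  toMulEquiv := e.toMulEquiv.trans f.toMulEquiv
  continuous_toFun := f.continuous_toFun.comp e.continuous_toFun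
  continuous_invFun := e.continuous_invFun.comp f.continuous_invFun
  map_pos := by
    rw [MulEquiv.coe_trans, Set.image_comp, e.map_pos, f.map_pos]

/-- The inverse of a morphism of `TM⊢` (every morphism is an isomorphism, as printed).
[cite: MochizukiAbsTopIII2015, Def 5.6 (i) p. 134] -/
def symm (e : TMMono.Iso M₁ M₂) : TMMono.Iso M₂ M₁ where
  toMulEquiv := e.toMulEquiv.symm
  continuous_toFun := e.continuous_invFun
  continuous_invFun := by simpa using e.continuous_toFun
  map_pos := by
    rw [← e.map_pos, ← Set.image_comp]
    simp

/-- Underlying isomorphism of the identity. [cite: MochizukiAbsTopIII2015, Def 5.6 (i) p. 134] -/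
@[simp] theorem refl_toMulEquiv (M : TMMono.{u}) : (refl M).toMulEquiv = MulEquiv.refl M.C := rfl

/-- Underlying isomorphism of a composite. [cite: MochizukiAbsTopIII2015, Def 5.6 (i) p. 134] -/
@[simp] theorem trans_toMulEquiv (e : TMMono.Iso M₁ M₂) (f : TMMono.Iso M₂ M₃) :
    (e.trans f).toMulEquiv = e.toMulEquiv.trans f.toMulEquiv := rfl

/-- Underlying isomorphism of the inverse. [cite: MochizukiAbsTopIII2015, Def 5.6 (i) p. 134] -/
@[simp] theorem symm_toMulEquiv (e : TMMono.Iso M₁ M₂) : e.symm.toMulEquiv = e.toMulEquiv.symm := rfl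

end TMMono.Iso

/-- **`TM⊢` is a groupoid** ([AbsTopIII] Def. 5.6 (i): objects `(C, C⃗)`, morphisms the isomorphisms of
topological monoids respecting `C⃗`). [cite: MochizukiAbsTopIII2015, Def 5.6 (i) p. 134] -/
instance TMMono.instGroupoid : Groupoid TMMono.{u} where
  Hom M₁ M₂ := TMMono.Iso M₁ M₂
  id M := TMMono.Iso.refl M
  comp e f := TMMono.Iso.trans e f
  id_comp e := by ext; rfl
  comp_id e := by ext; rfl
  assoc e f g := by ext; rfl
  inv e := TMMono.Iso.symm e
  inv_comp e := by
    apply TMMono.Iso.ext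
    ext x
    simp
  comp_inv e := by
    apply TMMono.Iso.ext
    ext x
    simp

/-- Unfolding: a morphism of the groupoid `TM⊢` IS a `TMMono.Iso`. [cite: MochizukiAbsTopIII2015, Def 5.6 (i) p. 134] -/
theorem TMMono.hom_eq (M₁ M₂ : TMMono.{u}) : (M₁ ⟶ M₂) = TMMono.Iso M₁ M₂ := rfl

/-- Every morphism of `TM⊢` is invertible (groupoid), with inverse the inverse isomorphism of monoids.
[cite: MochizukiAbsTopIII2015, Def 5.6 (i) p. 134] -/
theorem TMMono.inv_toMulEquiv {M₁ M₂ : TMMono.{u}} (e : M₁ ⟶ M₂) :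
    (Groupoid.inv e).toMulEquiv = e.toMulEquiv.symm := rfl

/-- Any two objects of `TM⊢` are isomorphic (both are `≅ 𝒪_ℂ^▷` as topological monoids) PROVIDED the
comparison isomorphism can be chosen to match the submonoids `C⃗` — which Def 5.6 (i) does not require
(Rmk 5.8.1 (i): `C⃗` is "non-rigid"); so we only record that `TM⊢` is nonempty: `𝒪_ℂ^▷` with
`C⃗ := ℝ_{≥0} ∩ 𝒪_ℂ^▷`-type data is abc-iut-L4-t3's model object. Here: the identity isomorphism
witnesses `Nonempty (M ≅ M)`. [cite: MochizukiAbsTopIII2015, Def 5.6 (i) p. 134] -/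
theorem TMMono.iso_refl_nonempty (M : TMMono.{u}) : Nonempty (M ≅ M) := ⟨CategoryTheory.Iso.refl M⟩

end Literature.AnabelianGeometry.AbsoluteAnabelian
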